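import Summits.Ventures.DiscreteObjects.Hadamard.CyclicCorePAF
import Summits.Ventures.DiscreteObjects.Hadamard.PrimeOrder167
import Summits.Ventures.DiscreteObjects.Hadamard.PlugIns668
import Summits.Ventures.DiscreteObjects.Hadamard.CompositeOrderTable
import Summits.Ventures.DiscreteObjects.Hadamard.CompositeOrder23

/-!
# H(668): an automorphism of order 167 yields a Goethals–Seidel quadruple over `ZMod 167` (kernel) — the order-167
# census line is PLAN-H's family F2

Framing: lottery ticket; floor = certified bounds/negative ranges.

Cell pub-namedobj (venture DiscreteObjects), target (H), hadamard gen 19.  `hadamard668_fixedRows_167` (gen 9): a signed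
automorphism `(π, κ, d, e)` of a Hadamard matrix of order `668` with `π^167 = κ^167 = 1`, `(π, κ) ≠ (1, 1)` is fixed-point-free
with `4 + 4` orbits of length `167`.  With the cyclic-core identity (`CyclicCorePAF.exists_paf_family_signed`): after re-signing,
any row `x₀` and a transversal `{y₁, y₂, y₃, y₄}` of the column orbits give four `±1` sequences `t ↦ H' x₀ (κ^t y_k)` on
`ZMod 167` whose periodic autocorrelations sum to `0 = −#Fix κ` at every shift `s ≠ 0`:
* **`gsQuad_of_hadamard668_signedAut_167`** — such an automorphism yields `a b c d : ZMod 167 → ℤ` with `GSQuad a b c d`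
  (four `±1` sequences with `PAF_a + PAF_b + PAF_c + PAF_d = 0` off `0`, i.e. supplementary difference sets
  `4-{167; k₁, k₂, k₃, k₄; Σ kᵢ − 167}`, i.e. four circulants `A, B, C, D` of order `167` with `AAᵀ + BBᵀ + CCᵀ + DDᵀ = 668·I`);
* **`exists_gsHadamard668_of_signedAut_167`** — hence (Goethals–Seidel array, `hadamard668_of_gsQuad`) a Hadamard matrix of
  order `668` of Goethals–Seidel type on `Fin 4 × ZMod 167`;
* **`gsQuad_of_hadamard668_orderOf_dvd_167`** — the same from `167 ∣ orderOf (π, κ)` (a suitable power has order `167`).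
So the order-167 line of the automorphism census (prime spectrum `{2,3,5,7,11,13,23,37,41,83,167}`) is EXACTLY the question
of PLAN-H's family F2 (Goethals–Seidel quadruples / SDS over `ZMod 167`, of which Williamson and propus quadruples are sub-cases):
if F2 is empty at `v = 167`, no H(668) has an automorphism of order `167`; the kernel sub-family exclusions already landed
(`no_gs167_qr_invariant`, `no_gs167_pairs_equal`, `no_gs167_three_equal`, GSRowSums167 / QRBlocks167) are therefore also
statements about `Aut` of a putative H(668).  The converse (GS-type ⇒ automorphism of order 167) is NOT claimed: the
Goethals–Seidel array with back-circulant off-diagonal blocks is not `ZMod 167`-invariant in general (the Williamson array with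
circulant blocks is).  Dictionary / structure of a hypothetical object; no order excluded; H(668) untouched.  The array ⇒ sequence
step is classical (regular cyclic action ⇒ circulant blocks; Goethals–Seidel 1970); the statements are ours; no `sorry`.
-/

namespace Summit.Ventures.DiscreteObjects.Hadamard

open Finset BigOperators Matrix

open Literature.Combinatorics.Designs.GoethalsSeidel (IsHadamardMatrix gsMatrix)
open Literature.Combinatorics.Designs.LegendrePairs (PAF IsPM)

variable {ι : Type*} [Fintype ι] [DecidableEq ι]

/-- a permutation with no fixed point according to the fixed-point count -/
lemma moved_of_card_fixed_eq_zero (σ : Equiv.Perm ι) (h : (univ.filter fun i => σ i = i).card = 0) (x : ι) : σ x ≠ x := by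
  intro hx
  have hmem : x ∈ univ.filter (fun i => σ i = i) := Finset.mem_filter.mpr ⟨Finset.mem_univ _, hx⟩
  rw [Finset.card_eq_zero.mp h] at hmem
  simp at hmem

/-- if no point is fixed, the moved points are all `|ι|` points -/
lemma card_moved_of_card_fixed_eq_zero (σ : Equiv.Perm ι) (h : (univ.filter fun i => σ i = i).card = 0) :
    (univ.filter fun i => σ i ≠ i).card = Fintype.card ι := by
  have := Finset.card_filter_add_card_filter_not (s := (univ : Finset ι)) (fun i => σ i = i)
  rw [h, zero_add, Finset.card_univ] at this
  exact this

/-- **Order 167 ⇒ a Goethals–Seidel quadruple over `ZMod 167`.**  A signed automorphism `(π, κ, d, e)` of a Hadamard matrix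
of order `668` with `π^167 = κ^167 = 1`, `(π, κ) ≠ (1, 1)` yields four `±1` sequences `a, b, c, d` on `ZMod 167` with
`PAF_a(s) + PAF_b(s) + PAF_c(s) + PAF_d(s) = 0` for all `s ≠ 0` (`GSQuad a b c d`). -/
theorem gsQuad_of_hadamard668_signedAut_167 {H : Matrix ι ι ℤ} (hH : IsHadamardMatrix H) (hι : Fintype.card ι = 668)
    {π κ : Equiv.Perm ι} {d e : ι → ℤ} (haut : IsSignedAut H π κ d e)
    (hπ : π ^ 167 = 1) (hκ : κ ^ 167 = 1) (hne : π ≠ 1 ∨ κ ≠ 1) :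
    ∃ a b c d : ZMod 167 → ℤ, GSQuad a b c d := by
  have h167 := hadamard668_fixedRows_167 hH hι π κ d e haut hπ hκ hne
  have hπfix : ∀ x, π x ≠ x := moved_of_card_fixed_eq_zero π h167.1
  have hκfix : ∀ y, κ y ≠ y := moved_of_card_fixed_eq_zero κ h167.2.1
  have p167 : Nat.Prime 167 := by norm_num
  have hfree : ∀ y, κ y ≠ y → ∀ k, 0 < k → k < 167 → (κ ^ k) y ≠ y :=
    fun y hy => free_of_fixed_prime_pow κ p167 (by rw [hκ, Equiv.Perm.one_apply]) hy
  obtain ⟨x₀⟩ : Nonempty ι := Fintype.card_pos_iff.mp (by rw [hι]; norm_num)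
  have hx₀ : ∀ k, 0 < k → k < 167 → (π ^ k) x₀ ≠ x₀ :=
    free_of_fixed_prime_pow π p167 (by rw [hπ, Equiv.Perm.one_apply]) (hπfix x₀)
  obtain ⟨T, hTcard, a, ha, hpaf⟩ := exists_paf_family_signed hH haut (by decide : Odd 167) hπ hκ hfree hx₀
  rw [card_moved_of_card_fixed_eq_zero κ h167.2.1, hι] at hTcard
  have hT4 : T.card = 4 := by omega
  rw [h167.2.1] at hpaf
  let eq4 : {y // y ∈ T} ≃ Fin 4 := Finset.equivFinOfCardEq hT4
  refine ⟨a (eq4.symm 0), a (eq4.symm 1), a (eq4.symm 2), a (eq4.symm 3), ha _, ha _, ha _, ha _, fun s hs => ?_⟩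
  have h := hpaf s hs
  have hre : ∑ i : Fin 4, PAF (a (eq4.symm i)) s = ∑ y, PAF (a y) s :=
    Fintype.sum_equiv eq4.symm _ _ (fun _ => rfl)
  rw [← hre, Fin.sum_univ_four] at h
  simpa using h

/-- **Order 167 ⇒ a Hadamard matrix of order 668 of Goethals–Seidel type.**  Under the same hypotheses there are `±1` sequences
`a, b, c, d` on `ZMod 167` with `GSQuad a b c d` whose Goethals–Seidel array `gsMatrix a b c d` is a Hadamard matrix of order
`668 = |Fin 4 × ZMod 167|`. -/
theorem exists_gsHadamard668_of_signedAut_167 {H : Matrix ι ι ℤ} (hH : IsHadamardMatrix H) (hι : Fintype.card ι = 668)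
    {π κ : Equiv.Perm ι} {d e : ι → ℤ} (haut : IsSignedAut H π κ d e)
    (hπ : π ^ 167 = 1) (hκ : κ ^ 167 = 1) (hne : π ≠ 1 ∨ κ ≠ 1) :
    ∃ a b c d : ZMod 167 → ℤ, GSQuad a b c d ∧ IsHadamardMatrix (gsMatrix a b c d) ∧
      Fintype.card (Fin 4 × ZMod 167) = 668 := by
  obtain ⟨a, b, c, d, h⟩ := gsQuad_of_hadamard668_signedAut_167 hH hι haut hπ hκ hne
  exact ⟨a, b, c, d, h, hadamard668_of_gsQuad a b c d h⟩

/-- **Order form.**  If `167` divides the order of the permutation pair `(π, κ)` of a signed automorphism of a Hadamard matrix of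
order `668`, there is a Goethals–Seidel quadruple over `ZMod 167` (and hence a GS-type H(668)). -/
theorem gsQuad_of_hadamard668_orderOf_dvd_167 {H : Matrix ι ι ℤ} (hH : IsHadamardMatrix H) (hι : Fintype.card ι = 668)
    {π κ : Equiv.Perm ι} {d e : ι → ℤ} (haut : IsSignedAut H π κ d e)
    (hdvd : 167 ∣ orderOf ((π, κ) : Equiv.Perm ι × Equiv.Perm ι)) :
    ∃ a b c d : ZMod 167 → ℤ, GSQuad a b c d := by
  set x : Equiv.Perm ι × Equiv.Perm ι := (π, κ) with hx
  have hx0 : orderOf x ≠ 0 := (orderOf_pos x).ne'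
  set k := orderOf x / 167 with hk
  have hord : orderOf (x ^ k) = 167 := orderOf_pow_orderOf_div hx0 hdvd
  have hxk : x ^ k = ((π ^ k, κ ^ k) : Equiv.Perm ι × Equiv.Perm ι) := by rw [hx, Prod.pow_mk]
  rw [hxk] at hord
  obtain ⟨h1, h2, h3⟩ := pow_data_of_orderOf hord (a := 1) Nat.one_pos (by norm_num)
  rw [pow_one, pow_one] at h3
  exact gsQuad_of_hadamard668_signedAut_167 hH hι (isSignedAut_pow haut k) h1 h2 h3

end Summit.Ventures.DiscreteObjects.Hadamard
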